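import Literature.AnabelianGeometry.EtaleTheta.Discharge.Sec5FirstDatumThetaTwistTower
import HarnessLib

/-!
# [EtTh] Def. 4.1 (iii) «fixed by `H_A`» at the fourth tower model: NO root of the theta function's fraction-pair is `H_⊙`-fixed above the
# anchor — the S-ANCHORED nested root datum `A_⊙ ← A_l ← A_N` (`NthRoot Rl.root Rl.pair N`, same setting as `Rl`) is UNINHABITED

S. Mochizuki, *The étale theta function …*, Publ. RIMS **45** (2009) [MochizukiEtTh2009], Def. 4.1 (ii)(iii) p.313 (PDF p.87) («`H_A^bs ⊆
Aut_D(A^bs)` the image of `H_⊙` … `f ∈ O^×(A^birat)` an element FIXED by the natural action of `H_A` … `(N, H_⊙, f)`-saturated»), Prop. 4.2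
p.314 (PDF p.88) (stated for `f ∈ O^×(A_⊙^birat)` — the ANCHOR), Prop. 5.2 (i) p.324 (PDF p.98) («an `N`-th root of a right fraction-pair of an
`l`-th root of `Θ̈` [cf. Remark 4.3.2]» — print RE-ANCHORS `A_⊙ ↦ A_l`), §1 p.241 (PDF p.15) (the Kummer class of `Θ̈`).
[cite: MochizukiEtTh2009, Def 4.1 (iii) p.313 (PDF p.87)]  PAGE CONVENTION for [EtTh]: «printed N (PDF p.M)», N = M + 226.

PROOF-ONLY (theorems only; abc-iut cell, layer L2, seat abc-iut-L2-d2 gen 8; abc-iut-L2-lead R1374/R1377 (α) «NESTED-ROOT FIXEDNESS WITNESS», the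
kernel form of this seat's finding F-L2d2g8-2 at the FOURTH-MODEL sockets).  SCOPE (correction (C2) of record): every theorem below is about
abc-iut-L2-t4's `settingTheta` (anchor `V_n`, `θ = thetaUnit n` = the level-`n` ROOT-unit `Θ̈_n`, whose skeleton `(0,0,0,1)` is PRIMITIVE); at the
junction's carrier of record (`settingSmall … M`, `θ = Θ̈` PROPER `= Θ̈_m^{N_m}`, skeleton NOT primitive) the same computation gives instead
«`fixed` ⟺ every element of `M` has `Θ̈`-class `≡ 0 (mod l)` at the root's level» — refuted for anchors carrying a class `≢ 0 (mod l)` (the faithful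
shape of the Ÿ-anchor), NOT for `V_j`-type anchors; that dichotomy is not proved in this file.  The typed nested binder
`R : S.NthRoot Rl.root Rl.pair N` of the §5 constructors (`ofBiKummerData`, `ofQuotientTemperoidData`; same setting `S` as the `l`-th root `Rl`)
carries `isSaturated.fixed : S.IsFixedByHA A_N _ ((α′)^* g_l)` — Def. 4.1 (iii)'s fixedness w.r.t. THE ANCHOR's `H_⊙ = Ker ρ_{A_⊙}`.  At the
fourth tower model with anchor `(Compat₃′/V_n, 0)` (abc-iut-L2-t4's `settingTheta`, p513309; theta datum `thetaUnit n` / `thetaFractionPair n`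
of this seat's A2 p507274; transport `pullFracModel`), `H_⊙ = φ⁻¹(V_n)` maps ONTO the deck group of every Galois covering of the anchor, all of
it lifting by `H_⊙`-ampleness, so fixedness forces the root's value at the base point to be `V_n`-INVARIANT at the covering's level `m`; but
`V_n` contains the pure Kummer element with `Θ̈`-class `N_n` (trivial below index `n`), which multiplies a level-`m` value of `Θ̈`-exponent `t` by
`ζ^{t·N_n}` (`ζ` of order `N_m`): invariance ⟺ `N_m ∣ t·N_n` ⟺ `e(n,m) ∣ t`; and `(g)^l = Θ̈_n|` reads `l·t = e(n,m)` at the base point (the theta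
skeleton `(0,0,0,1)` is PRIMITIVE) ⟹ `l = 1`.  Consumed BY NAME, nothing restated: `settingTheta` / `settingTheta_Hodot` (L2-t4), `thetaUnit`,
`thetaB₀`, `thetaFam_apply_mk` (this seat), `galoisSurjOf_apply_base` (abc-iut-L2-t3), `coe_biratAutModel_apply`, `coe_pullFracModel_apply`
(abc-iut-L6-t12 / w6-d037 vocabulary), `BZero_map_apply` (abc-iut-w6-d058), the FILE-4 level action `levelActFnMod` laws (abc-iut-L2-t11 / L1-t6).
* §1 level `m`: the pure Kummer element `k_n ∈ V_n` with `Θ̈`-class `N_n` (an `∃`, no definition) and its action `ζ ↦ ζ·ζ_m^{t N_n}`; invariance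
  ⟹ `N_m ∣ t·N_n`; `eT` is unchanged by the action and scales by `e` along the transitions.
* §2 **`actFn_apply_galoisBase_of_isFixedByHA`** — in `settingTheta R S n X φ hφ`: an `H_⊙`-ample `A` and an `H_A`-FIXED `f ∈ O^×(A^birat)` have
  `k · f(x_A) = f(x_A)` for EVERY `k ∈ V_n` (`x_A` the Galois base point of `A^bs`).
* §3 **`not_isFixedByHA_of_pow_eq_theta`** — no `H_⊙`-ample covering object carries an `H_A`-fixed `g` with `g^l = Θ̈_n|` for `l ≥ 2`; hence
  **`isEmpty_nthRoot_nested_theta`**: for every `l ≥ 2`, every `l`-th root `Rl` of (`thetaUnit n`, `thetaFractionPair n`) and every `N`, the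
  S-anchored `NthRoot Rl.root Rl.pair N pullFracModel` is EMPTY — abc-iut-L2-t4's FILE 1 `firstDatum … Rt …` (p513309) and this seat's B1
  `hinvc_theta` (p509012) quantify over an empty type at the fourth-model sockets (true, vacuous); the junction is re-typed on print's own forms
  (abc-iut-L2-lead R1374/R1385).
HONEST FRAMING: class-(b) combinatorial DESIGN carrier (NOT the tempered Frobenioid of a Tate curve); the emptiness is a property of the TYPED
S-anchored nesting (stronger than print), not a claim about print's §5, whose second form re-anchors; onto-socket `φ` design-only (R1257); nothing
here bears on [IUTchIII] Cor. 3.12; no side taken; typed ≠ proved.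
-/

noncomputable section

namespace Literature.AnabelianGeometry.EtaleTheta

open CategoryTheory Opposite Function Literature.AlgebraicGeometry.Frobenioids Literature.AlgebraicGeometry.Frobenioids.QuasiTemperoid
  Literature.AnabelianGeometry.SemiGraphs Literature.AnabelianGeometry.SemiGraphs.GaloisObjects LogDivisorModel LogDivisorModel.GaloisAction
  LogDivisorTower

namespace ThetaTwistTowerTempered

open LogDivisorModel.TateTowerThetaTwist TateTowerKummerTwistRShear
open TateTowerKummerTwist (M N N_dvd_M N_dvd_N eN eN_pos eN_self N_mul_eN eN_mul_eN M_dvd res)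
open TateTowerKummerTwistR (KumAdd Kum resK resK_apply)

/-! ## §1 Level `m`: the pure Kummer element of `V_n` with `Θ̈`-class `N_n`, and the `Θ̈`-exponent under actions and transitions -/

section Level

variable (n m : ℕ)

/-- The `Θ̈`-exponent of a function is unchanged by the action of «GRP₃′» (Kummer classes and the character touch only the root of unity; the
shear of a translation does not touch the `Θ̈`-exponent). [cite: MochizukiEtTh2009, Prop 1.4 (ii) p.248 (PDF p.22)] -/
theorem eT_toAdd_snd_actFn (g : Compat 3 thetaShear) (x : (towerC₃sf.Z m).Fn) :
    TateTowerTheta.eT (Multiplicative.toAdd ((towerC₃sf.act m).actFn g x).1.2) = TateTowerTheta.eT (Multiplicative.toAdd x.1.2) :=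
  (congrArg TateTowerTheta.eT (toAdd_snd_actFn m g x)).trans rfl

/-- The `Θ̈`-exponent scales by the ramification index `e(i,j)` along the tower's transition of functions. [cite: MochizukiEtTh2009, Def 3.3 (iii) p.300 (PDF p.74)] -/
theorem eT_toAdd_snd_resFn {i j : ℕ} (h : (levelsC 3 thetaShear).closure j ≤ (levelsC 3 thetaShear).closure i) (x : (towerC₃sf.Z i).Fn) :
    TateTowerTheta.eT (Multiplicative.toAdd (towerC₃sf.resFn h x).1.2) = (eN i j : ℤ) * TateTowerTheta.eT (Multiplicative.toAdd x.1.2) :=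
  rfl

/-- The `Θ̈`-exponent of a power. [cite: MochizukiEtTh2009, Def 3.3 (iii) p.300 (PDF p.74)] -/
theorem eT_toAdd_snd_pow (x : (towerC₃sf.Z m).Fn) (l : ℕ) :
    TateTowerTheta.eT (Multiplicative.toAdd (x ^ l).1.2) = (l : ℤ) * TateTowerTheta.eT (Multiplicative.toAdd x.1.2) := by
  induction l with
  | zero => rfl
  | succ l ih =>
    rw [pow_succ]
    change TateTowerTheta.eT ((Multiplicative.toAdd (x ^ l).1.2 : TateTowerTheta.Exp) + (Multiplicative.toAdd x.1.2 : TateTowerTheta.Exp)) = _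
    rw [TateTowerTheta.eT_add, ih]
    push_cast
    ring

/-- **The pure Kummer element `k_n ∈ V_n` with `Θ̈`-class `N_n` at every index** (`ϖ̈`- and `Ü`-classes `0`, character `1`, no translation):
compatible (a constant integer family), trivial below index `n` (`M_i = (i+2)! ∣ (n+1)! = N_n` for `i < n`). [cite: MochizukiEtTh2009, §1 p.241 (PDF p.15)] -/
theorem exists_kummerTheta_mem_vSub : ∃ k : Compat 3 thetaShear, k ∈ vSub 3 thetaShear n ∧ (k : Grp 3 thetaShear).right = 1 ∧
    ∀ j, (k : Grp 3 thetaShear).left.toAdd j = (fun a : Fin 3 => if a = 2 then ((((N n : ℕ+) : ℕ) : ℕ) : ZMod (M j)) else 0) := by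
  let κ : Kum 3 := Multiplicative.ofAdd fun j => (fun a : Fin 3 => if a = 2 then ((((N n : ℕ+) : ℕ) : ℕ) : ZMod (M j)) else 0)
  have hκ : ∀ {i j : ℕ} (h : i ≤ j), resK 3 h ((fun a : Fin 3 => if a = 2 then ((((N n : ℕ+) : ℕ) : ℕ) : ZMod (M j)) else 0)) =
      (fun a : Fin 3 => if a = 2 then ((((N n : ℕ+) : ℕ) : ℕ) : ZMod (M i)) else 0) := by
    intro i j h
    funext a
    rw [resK_apply]
    by_cases ha : a = 2
    · rw [if_pos ha, if_pos ha, map_natCast]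
    · rw [if_neg ha, if_neg ha, map_zero]
  have hmem : (SemidirectProduct.inl κ : Grp 3 thetaShear) ∈ compat 3 thetaShear := by
    refine ⟨fun i j h => ?_, fun i j h => ?_⟩
    · rw [SemidirectProduct.left_inl]
      exact hκ h
    · rw [SemidirectProduct.right_inl, Prod.fst_one, Pi.one_apply, Pi.one_apply, map_one]
  refine ⟨⟨SemidirectProduct.inl κ, hmem⟩, ?_, rfl, fun j => rfl⟩
  refine (mem_vSub_iff 3 thetaShear n _).2 ⟨rfl, fun i hi => ⟨?_, rfl⟩⟩
  change (fun a : Fin 3 => if a = 2 then ((((N n : ℕ+) : ℕ) : ℕ) : ZMod (M i)) else 0) = 0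
  have hdvd : M i ∣ ((N n : ℕ+) : ℕ) := Nat.factorial_dvd_factorial (by omega)
  funext a
  by_cases ha : a = 2
  · rw [if_pos ha, (ZMod.natCast_eq_zero_iff _ _).2 hdvd]; rfl
  · rw [if_neg ha]; rfl

/-- **The action of the pure Kummer element `k_n` at level `m`**: the root-of-unity coordinate is multiplied by `ζ_m^{t·N_n}`, `t` the
`Θ̈`-exponent; the skeleton is untouched. [cite: MochizukiEtTh2009, Def 3.3 (iii) p.299 (PDF p.73)] -/
theorem actFn_of_kummerTheta {k : Compat 3 thetaShear} (hk1 : (k : Grp 3 thetaShear).right = 1)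
    (hk2 : ∀ j, (k : Grp 3 thetaShear).left.toAdd j = (fun a : Fin 3 => if a = 2 then ((((N n : ℕ+) : ℕ) : ℕ) : ZMod (M j)) else 0)) (x : (towerC₃sf.Z m).Fn) :
    Multiplicative.toAdd ((towerC₃sf.act m).actFn k x).1.1 =
      Multiplicative.toAdd x.1.1 + TateTowerTheta.eT (Multiplicative.toAdd x.1.2) • ((((N n : ℕ+) : ℕ) : ℕ) : ZMod ((N m : ℕ+) : ℕ)) ∧
    ((towerC₃sf.act m).actFn k x).1.2 = x.1.2 := by
  have hk : (k : Grp 3 thetaShear) = SemidirectProduct.inl (k : Grp 3 thetaShear).left := by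
    rw [← SemidirectProduct.inl_left_mul_inr_right (k : Grp 3 thetaShear), hk1, map_one, mul_one, SemidirectProduct.left_inl]
  have e : ((towerC₃sf.act m).actFn k x).1 = levelActFnMod m ((N m : ℕ+) : ℕ) (N_dvd_M m) (k : Grp 3 thetaShear) x.1 := rfl
  rw [hk, levelActFnMod_inl, kumActMod_apply] at e
  refine ⟨?_, ?_⟩
  · rw [show ((towerC₃sf.act m).actFn k x).1.1 = (levelActFnMod m ((N m : ℕ+) : ℕ) (N_dvd_M m) (k : Grp 3 thetaShear) x.1).1 from rfl]
    rw [hk, levelActFnMod_inl, kumActMod_apply, kummerAut_fst, toAdd_mul, toAdd_ofAdd, hk2 m, pairing]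
    simp only [if_neg (show (0 : Fin 3) ≠ 2 by decide), if_neg (show (1 : Fin 3) ≠ 2 by decide), ite_true, map_zero, smul_zero,
      zero_add, map_natCast]
  · exact (congrArg Prod.snd e).trans (kummerAut_snd _ _)

/-- **Invariance under `k_n` at level `m` forces `N_m ∣ t·N_n`** (`t` the `Θ̈`-exponent). [cite: MochizukiEtTh2009, Def 3.3 (iii) p.299 (PDF p.73)] -/
theorem dvd_of_actFn_kummerTheta_eq {k : Compat 3 thetaShear} (hk1 : (k : Grp 3 thetaShear).right = 1)
    (hk2 : ∀ j, (k : Grp 3 thetaShear).left.toAdd j = (fun a : Fin 3 => if a = 2 then ((((N n : ℕ+) : ℕ) : ℕ) : ZMod (M j)) else 0)) {x : (towerC₃sf.Z m).Fn}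
    (hx : (towerC₃sf.act m).actFn k x = x) :
    (((N m : ℕ+) : ℕ) : ℤ) ∣ TateTowerTheta.eT (Multiplicative.toAdd x.1.2) * (((N n : ℕ+) : ℕ) : ℤ) := by
  have h := (actFn_of_kummerTheta n m hk1 hk2 x).1
  rw [hx, left_eq_add, zsmul_eq_mul, ← Int.cast_natCast, ← Int.cast_mul, ZMod.intCast_zmod_eq_zero_iff_dvd] at h
  exact h

end Level


/-! ## §2 In `settingTheta R S n X φ hφ`: an `H_A`-fixed birational unit takes a `V_n`-INVARIANT value at the Galois base point -/

section Setting

variable (R S : ((ConnectedPart (BTemp (Compat 3 thetaShear)))ᵒᵖ ⥤ CommMonCat.{0}) → Prop) (n : ℕ) {K : Type 1} [Field K]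
  (X : SemiGraphs.TemperedArithmeticGroup.{1} K) (φ : X.Pi →ₜ* Compat 3 thetaShear) (hφ : Function.Surjective φ)

/-- The birational action of `σ ∈ Aut_C(A)` at the fourth model, on the `B₀`-component, pointwise: `(σ·f)(s) = f(Base(σ⁻¹)(s))` (transport
along `Base(σ⁻¹)`; the level does not change). [cite: MochizukiEtTh2009, Def 4.1 (ii) p.313 (PDF p.87)] -/
theorem biratAutModel_fst_apply {A : (ThetaTwistTowerTempered.temperedFrobenioid R S).category} (σ : Aut A)
    (f : (ThetaTwistTowerTempered.temperedFrobenioid R S).biratUnitsModel A) (s : (gset A.base).V) :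
    ((((ThetaTwistTowerTempered.temperedFrobenioid R S).biratAutModel A σ f :
        (ThetaTwistTowerTempered.temperedFrobenioid R S).biratUnitsModel A) :
          (ThetaTwistTowerTempered.temperedFrobenioid R S).ratFnFunctor.obj (op A.base)).1.1).1 s =
      (((f : (ThetaTwistTowerTempered.temperedFrobenioid R S).ratFnFunctor.obj (op A.base)).1.1).1
        ((ModelFrobenioid.baseMap σ.inv).hom.hom.hom s)) := by
  show towerC₃sf.resFn _ ((((f : (ThetaTwistTowerTempered.temperedFrobenioid R S).ratFnFunctor.obj (op A.base)).1.1).1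
    ((ModelFrobenioid.baseMap σ.inv).hom.hom.hom s))) = _
  exact towerC₃sf.resFn_refl _ _

/-- **In `settingTheta R S n X φ hφ` (anchor `(Compat₃′/V_n, 0)`, `H_⊙ = φ⁻¹(V_n)`): if `A` is `H_⊙`-ample and `f ∈ O^×(A^birat)` is FIXED by
`H_A` (Def. 4.1 (iii)), then the value of `f` at the Galois base point `x_A` of `A^bs` is `V_n`-INVARIANT** — `H_⊙` maps onto the deck
transformations `x_A ↦ k⁻¹·x_A` (`k ∈ V_n`), each lifts to `Aut_C(A)` by ampleness, and the lift transports `f` along it.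
[cite: MochizukiEtTh2009, Def 4.1 (iii) p.313 (PDF p.87)] -/
theorem actFn_apply_galoisBase_of_isFixedByHA {A : (ThetaTwistTowerTempered.temperedFrobenioid R S).category} (hA : IsGaloisObj A.base.obj)
    (hsurj : (settingTheta R S n X φ hφ).HAbs A hA ≤ ((settingTheta R S n X φ hφ).autBase A).range)
    (f : (ThetaTwistTowerTempered.temperedFrobenioid R S).biratUnitsModel A)
    (hfix : (settingTheta R S n X φ hφ).IsFixedByHA A hA f) {k : Compat 3 thetaShear} (hk : k ∈ vSub 3 thetaShear n) :
    (towerC₃sf.act (lvlC 3 thetaShear A.base)).actFn k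
        ((((f : (ThetaTwistTowerTempered.temperedFrobenioid R S).ratFnFunctor.obj (op A.base)).1.1).1
          (galoisBase (isTemperedC 3 thetaShear) A.base.obj hA))) =
      (((f : (ThetaTwistTowerTempered.temperedFrobenioid R S).ratFnFunctor.obj (op A.base)).1.1).1
        (galoisBase (isTemperedC 3 thetaShear) A.base.obj hA)) := by
  -- (`cases` on the existentials is avoided on purpose: it triggers an expensive definitional unfolding of the setting in this context)
  let x : X.Pi := (hφ k).choose
  have hx : φ x = k := (hφ k).choose_spec
  have hxH : x ∈ (settingTheta R S n X φ hφ).Hodot := by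
    rw [settingTheta_Hodot, Subgroup.mem_comap]
    change φ x ∈ (vOpenNormal 3 thetaShear n).toSubgroup
    rw [hx]
    exact hk
  have hτ : (settingTheta R S n X φ hφ).galoisSurj A.base hA x ∈ (settingTheta R S n X φ hφ).HAbs A hA :=
    Subgroup.mem_map_of_mem _ hxH
  let σ : Aut A := (MonoidHom.mem_range.1 (hsurj hτ)).choose
  have hσ : (settingTheta R S n X φ hφ).autBase A σ = (settingTheta R S n X φ hφ).galoisSurj A.base hA x :=
    (MonoidHom.mem_range.1 (hsurj hτ)).choose_spec
  have hσmem : σ ∈ (settingTheta R S n X φ hφ).HA A hA := by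
    change σ ∈ Subgroup.comap _ _
    rw [Subgroup.mem_comap]
    exact (congrArg (· ∈ (settingTheta R S n X φ hφ).HAbs A hA) hσ).mpr hτ
  have hf : (ThetaTwistTowerTempered.temperedFrobenioid R S).biratAutModel A σ f = f := hfix σ hσmem
  -- the lift transports `f` along `Base(σ⁻¹) = ρ_A(x)⁻¹ = galoisSurjOf(φ x⁻¹)`, which moves `x_A` to `(φ x)·x_A = k·x_A`
  have hpt := biratAutModel_fst_apply R S σ f (galoisBase (isTemperedC 3 thetaShear) A.base.obj hA)
  have hval := congrArg (fun u : (ThetaTwistTowerTempered.temperedFrobenioid R S).biratUnitsModel A =>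
    (((u : (ThetaTwistTowerTempered.temperedFrobenioid R S).ratFnFunctor.obj (op A.base)).1.1).1
      (galoisBase (isTemperedC 3 thetaShear) A.base.obj hA))) hf
  have hb : ModelFrobenioid.baseMap σ.inv = ((settingTheta R S n X φ hφ).autBase A σ).inv := rfl
  have hmove : (ModelFrobenioid.baseMap σ.inv).hom.hom.hom (galoisBase (isTemperedC 3 thetaShear) A.base.obj hA) =
      (gset A.base).ρ k (galoisBase (isTemperedC 3 thetaShear) A.base.obj hA) := by
    rw [hb, hσ, ← Iso.symm_hom, ← Aut.Aut_inv_def, ← map_inv]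
    change ((galoisSurjOf (isTemperedC 3 thetaShear) A.base.obj hA (φ x⁻¹)).hom.hom.hom
      (galoisBase (isTemperedC 3 thetaShear) A.base.obj hA) : A.base.obj.obj.V) = _
    rw [galoisSurjOf_apply_base, map_inv φ x, inv_inv, hx]
  have hρ := congrArg (((f : (ThetaTwistTowerTempered.temperedFrobenioid R S).ratFnFunctor.obj (op A.base)).1.1).1) hmove
  exact ((((f : (ThetaTwistTowerTempered.temperedFrobenioid R S).ratFnFunctor.obj (op A.base)).1.1).2.2 k
    (galoisBase (isTemperedC 3 thetaShear) A.base.obj hA)).symm.trans (hρ.symm.trans (hpt.symm.trans hval)))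

end Setting


/-! ## §3 The theta function: no `H_A`-fixed `l`-th root above the anchor; the S-anchored nested root datum is EMPTY -/

section Theta

variable (R S : ((ConnectedPart (BTemp (Compat 3 thetaShear)))ᵒᵖ ⥤ CommMonCat.{0}) → Prop) (n : ℕ)

/-- The `Θ̈`-exponent of the theta function `Θ̈_n ∈ B₀(Y_n)` is `1` at EVERY point (translations shear `ϖ̈`, `Ü` only; the theta skeleton
`(0,0,0,1)` is primitive). [cite: MochizukiEtTh2009, Prop 1.4 (ii) p.248 (PDF p.22)] -/
theorem eT_thetaB₀_apply (s : (gset (YV n)).V) : TateTowerTheta.eT (Multiplicative.toAdd ((thetaB₀ n).1 s).1.2) = 1 := by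
  obtain ⟨a, rfl⟩ := exists_ρ_yV_eq n s
  have e : (thetaB₀ n).1 ((gset (YV n)).ρ a (yV n)) =
      (towerC₃sf.act (lvlC 3 thetaShear (YV n))).actFn a ((thetaB₀ n).1 (yV n)) := (thetaB₀ n).2.2 a (yV n)
  rw [e, eT_toAdd_snd_actFn]
  change TateTowerTheta.eT (Multiplicative.toAdd ((thetaFam n (lvlC 3 thetaShear (YV n)) (lvlC_YV n).le).1 (yV n)).1.2) = 1
  rw [thetaFam_apply_yV]
  rfl

/-- The `B₀`-component of the theta function `Θ̈ ∈ O^×(A_⊙^birat)` IS `Θ̈_n ∈ B₀(Y_n)`. [cite: MochizukiEtTh2009, §5 p.330 (PDF p.104)] -/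
theorem fst_coe_thetaUnit :
    ((thetaUnit R S n : (ThetaTwistTowerTempered.temperedFrobenioid R S).biratUnitsModel (Aodot R S n)) :
        (ThetaTwistTowerTempered.temperedFrobenioid R S).ratFnFunctor.obj (op (Aodot R S n).base)).1.1 = thetaB₀ n :=
  congrArg (fun p : (ThetaTwistTowerTempered.temperedFrobenioid R S).ratFnFunctor.obj (op (Aodot R S n).base) => p.1.1) (coe_thetaUnit R S n)

variable {K : Type 1} [Field K] (X : SemiGraphs.TemperedArithmeticGroup.{1} K) (φ : X.Pi →ₜ* Compat 3 thetaShear) (hφ : Function.Surjective φ)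

/-- Powers in `B(A^bs)` are pointwise on the `B₀`-component. [cite: MochizukiEtTh2009, Def 3.6 (ii) p.303 (PDF p.77)] -/
theorem fst_apply_pow {Y : ConnectedPart (BTemp (Compat 3 thetaShear))}
    (p : (ThetaTwistTowerTempered.temperedFrobenioid R S).ratFnFunctor.obj (op Y)) (s : (gset Y).V) (l : ℕ) :
    ((p ^ l).1.1).1 s = ((p.1.1).1 s) ^ l :=
  let ev : (ThetaTwistTowerTempered.temperedFrobenioid R S).ratFnFunctor.obj (op Y) →* (towerC₃sf.Z (lvlC 3 thetaShear Y)).Fn :=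
    { toFun := fun q => (q.1.1).1 s, map_one' := rfl, map_mul' := fun _ _ => rfl }
  map_pow ev p l

/-- Pull-back of birational units at the fourth model, on the `B₀`-component, pointwise: `(ψ^* w)(s) = res (w (Base(ψ)(s)))`.
[cite: MochizukiEtTh2009, Prop 4.2 p.314 (PDF p.88)] -/
theorem pullFracModel_fst_apply {A B : (ThetaTwistTowerTempered.temperedFrobenioid R S).category} (ψ : A ⟶ B)
    (w : (ThetaTwistTowerTempered.temperedFrobenioid R S).biratUnitsModel B) (s : (gset A.base).V) :
    ((((ThetaTwistTowerTempered.temperedFrobenioid R S).pullFracModel ψ w :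
        (ThetaTwistTowerTempered.temperedFrobenioid R S).biratUnitsModel A) :
          (ThetaTwistTowerTempered.temperedFrobenioid R S).ratFnFunctor.obj (op A.base)).1.1).1 s =
      towerC₃sf.resFn ((levelsC 3 thetaShear).closure_lvl_mono (ModelFrobenioid.baseMap ψ))
        ((((w : (ThetaTwistTowerTempered.temperedFrobenioid R S).ratFnFunctor.obj (op B.base)).1.1).1
          ((ModelFrobenioid.baseMap ψ).hom.hom.hom s))) := rfl

/-- Hence the `Θ̈`-exponent of a pulled-back unit at a point is `e` times that of the unit at the image point. [cite: MochizukiEtTh2009, Prop 4.2 p.314 (PDF p.88)] -/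
theorem eT_pullFracModel_fst_apply {A B : (ThetaTwistTowerTempered.temperedFrobenioid R S).category} (ψ : A ⟶ B)
    (w : (ThetaTwistTowerTempered.temperedFrobenioid R S).biratUnitsModel B) (s : (gset A.base).V) :
    TateTowerTheta.eT (Multiplicative.toAdd (((((ThetaTwistTowerTempered.temperedFrobenioid R S).pullFracModel ψ w :
        (ThetaTwistTowerTempered.temperedFrobenioid R S).biratUnitsModel A) :
          (ThetaTwistTowerTempered.temperedFrobenioid R S).ratFnFunctor.obj (op A.base)).1.1).1 s).1.2) =
      (eN (lvlC 3 thetaShear B.base) (lvlC 3 thetaShear A.base) : ℤ) *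
        TateTowerTheta.eT (Multiplicative.toAdd ((((w : (ThetaTwistTowerTempered.temperedFrobenioid R S).ratFnFunctor.obj (op B.base)).1.1).1
          ((ModelFrobenioid.baseMap ψ).hom.hom.hom s)).1.2)) :=
  (congrArg (fun z : (towerC₃sf.Z (lvlC 3 thetaShear A.base)).Fn => TateTowerTheta.eT (Multiplicative.toAdd z.1.2))
    (pullFracModel_fst_apply R S ψ w s)).trans (eT_toAdd_snd_resFn _ _)

/-- **NO `H_A`-FIXED ROOT OF `Θ̈` ABOVE THE ANCHOR** (fourth model, `settingTheta R S n X φ hφ`): if `A → A′ → A_⊙` are morphisms of `C`, `A` is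
`H_⊙`-ample, `g ∈ O^×(A^birat)` is fixed by `H_A`, and `g^l = Θ̈|_A` (pulled back along the two steps), then `l = 1` — for `l ≥ 2` a
contradiction: at the Galois base point `x_A` (level `m`), `l · t = e(n,m)` (`t` the `Θ̈`-exponent of `g(x_A)`) while `V_n`-invariance under the
pure Kummer element gives `N_m ∣ t · N_n`, i.e. `e(n,m) ∣ t`. [cite: MochizukiEtTh2009, Def 4.1 (iii) p.313 (PDF p.87)] -/
theorem not_isFixedByHA_of_pow_eq_theta {A A' : (ThetaTwistTowerTempered.temperedFrobenioid R S).category} (ψ₂ : A ⟶ A') (ψ₁ : A' ⟶ Aodot R S n)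
    (hA : IsGaloisObj A.base.obj) (hsurj : (settingTheta R S n X φ hφ).HAbs A hA ≤ ((settingTheta R S n X φ hφ).autBase A).range)
    (g : (ThetaTwistTowerTempered.temperedFrobenioid R S).biratUnitsModel A) (hfix : (settingTheta R S n X φ hφ).IsFixedByHA A hA g)
    {l : ℕ} (hl : 2 ≤ l)
    (hpow : g ^ l = (ThetaTwistTowerTempered.temperedFrobenioid R S).pullFracModel ψ₂
      ((ThetaTwistTowerTempered.temperedFrobenioid R S).pullFracModel ψ₁ (thetaUnit R S n))) : False := by
  -- levels `n ≤ m′ ≤ m`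
  have hn : lvlC 3 thetaShear (Aodot R S n).base = n := lvlC_YV n
  have h₁ : lvlC 3 thetaShear (Aodot R S n).base ≤ lvlC 3 thetaShear A'.base := lvlC_le_of_hom 3 thetaShear (ModelFrobenioid.baseMap ψ₁)
  have h₂ : lvlC 3 thetaShear A'.base ≤ lvlC 3 thetaShear A.base := lvlC_le_of_hom 3 thetaShear (ModelFrobenioid.baseMap ψ₂)
  -- the value of `g` at the Galois base point and its `Θ̈`-exponent `t`
  let y : (towerC₃sf.Z (lvlC 3 thetaShear A.base)).Fn :=
    (((g : (ThetaTwistTowerTempered.temperedFrobenioid R S).ratFnFunctor.obj (op A.base)).1.1).1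
      (galoisBase (isTemperedC 3 thetaShear) A.base.obj hA))
  -- (1) `V_n`-invariance under the pure Kummer element `k_n` ⟹ `N_m ∣ t · N_n`
  obtain ⟨k, hk, hk1, hk2⟩ := exists_kummerTheta_mem_vSub n
  have hinv : (towerC₃sf.act (lvlC 3 thetaShear A.base)).actFn k y = y :=
    actFn_apply_galoisBase_of_isFixedByHA R S n X φ hφ hA hsurj g hfix hk
  have hdvd := dvd_of_actFn_kummerTheta_eq n (lvlC 3 thetaShear A.base) hk1 hk2 hinv
  -- (2) `g^l = Θ̈|` at the base point: `l · t = e(m′,m) · e(n,m′) · 1`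
  have hl_pow : TateTowerTheta.eT (Multiplicative.toAdd
      ((((g ^ l : (ThetaTwistTowerTempered.temperedFrobenioid R S).biratUnitsModel A) :
        (ThetaTwistTowerTempered.temperedFrobenioid R S).ratFnFunctor.obj (op A.base)).1.1).1
        (galoisBase (isTemperedC 3 thetaShear) A.base.obj hA)).1.2) = (l : ℤ) * TateTowerTheta.eT (Multiplicative.toAdd y.1.2) := by
    let ev : (ThetaTwistTowerTempered.temperedFrobenioid R S).biratUnitsModel A →* (towerC₃sf.Z (lvlC 3 thetaShear A.base)).Fn :=
      { toFun := fun u => (((u : (ThetaTwistTowerTempered.temperedFrobenioid R S).ratFnFunctor.obj (op A.base)).1.1).1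
          (galoisBase (isTemperedC 3 thetaShear) A.base.obj hA)),
        map_one' := rfl, map_mul' := fun _ _ => rfl }
    exact (congrArg (fun z : (towerC₃sf.Z (lvlC 3 thetaShear A.base)).Fn => TateTowerTheta.eT (Multiplicative.toAdd z.1.2))
      (map_pow ev g l)).trans (eT_toAdd_snd_pow _ y l)
  have hr_pow : TateTowerTheta.eT (Multiplicative.toAdd
      (((((ThetaTwistTowerTempered.temperedFrobenioid R S).pullFracModel ψ₂
          ((ThetaTwistTowerTempered.temperedFrobenioid R S).pullFracModel ψ₁ (thetaUnit R S n)) :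
        (ThetaTwistTowerTempered.temperedFrobenioid R S).biratUnitsModel A) :
        (ThetaTwistTowerTempered.temperedFrobenioid R S).ratFnFunctor.obj (op A.base)).1.1).1
        (galoisBase (isTemperedC 3 thetaShear) A.base.obj hA)).1.2) =
      (eN (lvlC 3 thetaShear A'.base) (lvlC 3 thetaShear A.base) : ℤ) *
        ((eN (lvlC 3 thetaShear (Aodot R S n).base) (lvlC 3 thetaShear A'.base) : ℤ) * 1) := by
    rw [eT_pullFracModel_fst_apply, eT_pullFracModel_fst_apply, fst_coe_thetaUnit, eT_thetaB₀_apply]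
  have hpow' := congrArg (fun u : (ThetaTwistTowerTempered.temperedFrobenioid R S).biratUnitsModel A =>
    TateTowerTheta.eT (Multiplicative.toAdd ((((u : (ThetaTwistTowerTempered.temperedFrobenioid R S).ratFnFunctor.obj (op A.base)).1.1).1
      (galoisBase (isTemperedC 3 thetaShear) A.base.obj hA)).1.2))) hpow
  have heq : (l : ℤ) * TateTowerTheta.eT (Multiplicative.toAdd y.1.2) =
      (eN (lvlC 3 thetaShear A'.base) (lvlC 3 thetaShear A.base) : ℤ) *
        ((eN (lvlC 3 thetaShear (Aodot R S n).base) (lvlC 3 thetaShear A'.base) : ℤ) * 1) :=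
    hl_pow.symm.trans (hpow'.trans hr_pow)
  -- (3) arithmetic: `l · t = e(n,m)` and `e(n,m) ∣ t` force `l = 1`
  rw [hn] at h₁ heq
  rw [mul_one, ← Nat.cast_mul, mul_comm (eN _ _), eN_mul_eN h₁ h₂] at heq
  have hN : (((N (lvlC 3 thetaShear A.base) : ℕ+) : ℕ) : ℤ) = (((N n : ℕ+) : ℕ) : ℤ) * (eN n (lvlC 3 thetaShear A.base) : ℤ) := by
    rw [← Nat.cast_mul, N_mul_eN (h₁.trans h₂)]
  rw [hN, mul_comm (((N n : ℕ+) : ℕ) : ℤ)] at hdvd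
  have hNn : (((N n : ℕ+) : ℕ) : ℤ) ≠ 0 := by exact_mod_cast (N n).ne_zero
  obtain ⟨q, hq⟩ := (mul_dvd_mul_iff_right hNn).1 hdvd
  have hE : (eN n (lvlC 3 thetaShear A.base) : ℤ) ≠ 0 := by exact_mod_cast (eN_pos (h₁.trans h₂)).ne'
  have h3 : (eN n (lvlC 3 thetaShear A.base) : ℤ) * ((l : ℤ) * q) = (eN n (lvlC 3 thetaShear A.base) : ℤ) * 1 := by
    rw [hq] at heq
    linear_combination heq
  have hlq : (l : ℤ) * q = 1 := mul_left_cancel₀ hE h3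
  have hl1 : (l : ℤ) = 1 := Int.eq_one_of_mul_eq_one_right (by positivity) hlq
  omega

variable {l N : ℕ+} (hl : 2 ≤ (l : ℕ))
  (Rl : (settingTheta R S n X φ hφ).NthRoot (thetaUnit R S n)
    (thetaFractionPair R S n X _ _ _ (fun _ _ _ => True) _ (isFrobeniusTrivial_Aodot R S n) (isGaloisObj_Aodot_base R S n)) l
    (fun {_} ψ x => (ThetaTwistTowerTempered.temperedFrobenioid R S).pullFracModel ψ x))

include hl in
/-- **THE S-ANCHORED NESTED ROOT DATUM IS REFUTED**: for `l ≥ 2`, every `l`-th root `Rl` of the theta function's fraction-pair in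
`settingTheta R S n X φ hφ` (pull-back of record `pullFracModel`) and every `N`, an `N`-th root `R` of `(g_l; s′_l, s″_l)` IN THE SAME SETTING
(`isSaturated` w.r.t. the anchor's `H_⊙ = φ⁻¹(V_n)`) yields `False` — its `isSaturated.fixed` makes `(α′)^* g_l` an `H_{A_N}`-fixed `l`-th root of
`Θ̈|` above the anchor. [cite: MochizukiEtTh2009, Def 4.1 (iii) p.313 (PDF p.87); Prop 5.2 (i) p.324 (PDF p.98)] -/
theorem false_of_nthRoot_nested_theta
    (Rt : (settingTheta R S n X φ hφ).NthRoot Rl.root Rl.pair N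
      (fun {_} ψ x => (ThetaTwistTowerTempered.temperedFrobenioid R S).pullFracModel ψ x)) : False := by
  refine not_isFixedByHA_of_pow_eq_theta R S n X φ hφ Rt.αData.α₁ Rl.αData.α₁ Rt.isSaturated.isAmple.isGalois Rt.isSaturated.isAmple.surj
    ((ThetaTwistTowerTempered.temperedFrobenioid R S).pullFracModel Rt.αData.α₁ Rl.root) Rt.isSaturated.fixed hl ?_
  exact (map_pow ((ThetaTwistTowerTempered.temperedFrobenioid R S).pullFracModel Rt.αData.α₁) Rl.root (l : ℕ)).symm.trans
    (congrArg ((ThetaTwistTowerTempered.temperedFrobenioid R S).pullFracModel Rt.αData.α₁) Rl.pow_root)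

include hl in
/-- **`IsEmpty` form**: the type of S-anchored `N`-th roots of the `l`-th root's fraction-pair is EMPTY (`l ≥ 2`, every `N`) — abc-iut-L2-t4's
FILE 1 `firstDatum … Rt …` (p513309) and this seat's `hinvc_theta` (p509012) quantify over it; print's second form RE-ANCHORS (`A_⊙ ↦ A_l`,
abc-iut-L2-t3 p514034), on which the junction is re-typed (abc-iut-L2-lead R1374). [cite: MochizukiEtTh2009, Prop 5.2 (i) p.324 (PDF p.98)] -/
theorem isEmpty_nthRoot_nested_theta :
    IsEmpty ((settingTheta R S n X φ hφ).NthRoot Rl.root Rl.pair N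
      (fun {_} ψ x => (ThetaTwistTowerTempered.temperedFrobenioid R S).pullFracModel ψ x)) :=
  ⟨fun Rt => false_of_nthRoot_nested_theta R S n X φ hφ hl Rl Rt⟩

end Theta

end ThetaTwistTowerTempered

end Literature.AnabelianGeometry.EtaleTheta

end
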